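import Literature.NumberTheory.EllipticCurves.DivisionPointReadingsAtLevel
import Literature.NumberTheory.ComplexMultiplication.EllipticUnits.DeShalitDivisionPointsLatticeVbarCube
import HarnessLib

/-!
# Readings of division points at one level when `v̄² ∣ 𝔪` — the sixteen-object block of (N1)-PKG WITHOUT `2^k ∉ 𝔪`
# (de Shalit II.1.5 (15), II.1.10, II.4.4 (iv); tame set `S = ∅` included — proofs only)

Topic `NumberTheory/EllipticCurves` (theorems only; no definition, no named fact, no instance, no `sorry`).  Cell `bsd-print-cf2`,
width seat `bsd-line-cf2-p1-w5` g18, piece (N1)-S∅, sequel of `DivisionPointReadingsAtLevel` (cf2c-w4 g16).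

`DivisionPointReadingsAtLevel.exists_divisionPt_readings_at_level` supplies the four reading families of
`DivisionPointsKernelMembership.some_mem_kernel_divisionPt_of_readings` under `h𝔪2 : ∀ k, 2^k ∉ 𝔪`.  On the lane the modulus is
`𝔪 = 𝔪_M = ∏_{w ∈ S ∪ {v̄}} w^M`, and `2^M ∈ 𝔪_M` exactly when the tame set `S` is empty; the hypothesis served only the two
non-memberships `Ω + (k·u_{N+1} + ub) ∉ L`, `ι(π₀)·(Ω + (k·u_{N+1} + ub)) ∉ L` (and `π₁ ≠ 0`), which
`DeShalitDivisionPointsLatticeVbarCube` proves from `𝔪 ≤ (π₁²)` with `π₁` prime and `π₀ + π₁ = 1` instead.  Hence: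

* `exists_mul_mem_and_notMem` — a `𝔭̄`-division point `ub` (`ι(π₁)ub ∈ L`, `ub ∉ L`) EXISTS as soon as `𝔪 ≠ 0`, `𝔪 ≤ (π₁)`
  (the binders `hub1 hub0`);
* ★★★ `exists_divisionPt_readings_at_level_of_le_span_sq` — the statement of `exists_divisionPt_readings_at_level` VERBATIM with
  `h𝔪2` replaced by `(hprime₁ : Prime π₁) (h𝔪π₁ : 𝔪 ≤ Ideal.span {π₁ ^ 2})` (every lane modulus `𝔪_M`, `M ≥ 2`, `S = ∅` included;
  proof = the original with the two non-membership calls swapped).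

No summit statement is proved; BSD is not proved by any of this.

## References
* [deShalit1987] E. de Shalit, *Iwasawa theory of elliptic curves with complex multiplication* (1987), II §1.5 (15) (p. 42),
  II §1.10 Lemma (p. 39), II §4.4 (iv) (p. 57–58), II §4.9 (23) (p. 62–63).
* [SilvermanAEC2009] J. H. Silverman, *The Arithmetic of Elliptic Curves*, 2nd ed. (2009), III.1, VI.3.6 (b).
-/

noncomputable section

open scoped Classical NumberField
open NumberField IsDedekindDomain IsDedekindDomain.HeightOneSpectrum Field PeriodPair
open Literature.NumberTheory.NumberFields Literature.NumberTheory.GaloisRepresentations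
  Literature.NumberTheory.GaloisRepresentations.IsNonarchimedeanLocalField Literature.NumberTheory.GaloisRepresentations.LubinTate
  Literature.NumberTheory.ComplexMultiplication.EllipticUnits

namespace Literature.NumberTheory.EllipticCurves

namespace DivisionPointReadings

variable {K : Type} [Field K] [NumberField K] (ι : K →+* ℂ) (L : PeriodPair) (W : WeierstrassCurve ℤ) {𝔣ψ : Ideal (𝓞 K)}
  [IsTotallyComplex K] {v : HeightOneSpectrum (𝓞 K)} {𝔑 𝔪 : Ideal (𝓞 K)} {Ω : ℂ} {π₀ β : 𝓞 K} {ub : ℂ} {π₁ : 𝓞 K}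

/-! ## §0 A `𝔭̄`-division point of the model lattice (`v̄ ∣ 𝔪`) -/

omit [IsTotallyComplex K] in
/-- ★ **A `𝔭̄`-division point of the model lattice exists when `v̄ ∣ 𝔪`**: for `L = Ω·ι(𝔪)`, `𝔪 ≠ 0`, `𝔪 ≤ (π₁)`, `π₁` prime, there
is `ub` with `ι(π₁)·ub ∈ L` and `ub ∉ L` — `ub = Ω·ι(γ)` for any `γ ∈ (𝔪 : (π₁)) ∖ 𝔪` (`𝔪 = (π₁)·J`, and `J ≤ 𝔪` would force
`(π₁) = (1)`) — the binders `hub1 hub0` of `exists_divisionPt_readings_at_level(_of_le_span_sq)` and of (N1)-PKG.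
[cite: deShalit1987, II §4.4 (iv)] -/
theorem exists_mul_mem_and_notMem (hL : ∀ z : ℂ, z ∈ L.lattice ↔ ∃ a ∈ 𝔪, z = Ω * ι (a : K)) (hΩ : Ω ≠ 0) (h𝔪0 : 𝔪 ≠ ⊥)
    (hprime₁ : Prime π₁) (h𝔪π₁ : 𝔪 ≤ Ideal.span {π₁}) :
    ∃ ub : ℂ, ι (π₁ : K) * ub ∈ L.lattice ∧ ub ∉ L.lattice := by
  obtain ⟨J, hJ⟩ := Ideal.dvd_iff_le.mpr h𝔪π₁
  have hJ0 : J ≠ ⊥ := fun h => h𝔪0 (by rw [hJ, h, Ideal.mul_bot])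
  have hJ𝔪 : ¬ J ≤ 𝔪 := by
    intro hle
    have hJeq : J = 𝔪 := le_antisymm hle (hJ ▸ Ideal.mul_le_left)
    have h1 : Ideal.span {π₁} * J = ⊤ * J := by rw [Ideal.top_mul, ← hJ, hJeq]
    exact hprime₁.not_unit (Ideal.span_singleton_eq_top.mp (mul_right_cancel₀ hJ0 h1))
  obtain ⟨γ, hγJ, hγ𝔪⟩ := SetLike.not_le_iff_exists.mp hJ𝔪
  refine ⟨Ω * ι (γ : K), ?_, fun h => hγ𝔪 ((mul_mem_lattice_iff_of_model ι hL hΩ γ).mp h)⟩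
  have hmem : π₁ * γ ∈ 𝔪 := hJ ▸ Ideal.mul_mem_mul (Ideal.mem_span_singleton_self π₁) hγJ
  have e : ι (π₁ : K) * (Ω * ι (γ : K)) = Ω * ι ((π₁ * γ : 𝓞 K) : K) := by push_cast; rw [map_mul]; ring
  rw [e]
  exact (hL _).mpr ⟨π₁ * γ, hmem, rfl⟩

open ValuativeRel in
/-- ★★★ **READINGS for (N1)-PKG at one level `m`, modulus divisible by `v̄²` (tame set `S = ∅` included)**: the statement of
`exists_divisionPt_readings_at_level` VERBATIM except that the hypothesis `h𝔪2 : ∀ k, 2^k ∉ 𝔪` (false for `𝔪 = v̄^M`) is replaced by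
`(hprime₁ : Prime π₁) (h𝔪π₁ : 𝔪 ≤ Ideal.span {π₁ ^ 2})` — the four reading families `Y`: `ξ(u_{N+1})`, `S`: `ξ(k·u_{N+1} + ub)`,
`W`: `ξ(Ω + (k·u_{N+1} + ub))`, `Z`: `ξ(αc·(Ω + (k·u_{N+1} + ub)))` (`αc = ι(π₀)`) at level `m`, with the sixteen reading equations for
`N ≤ m` (all `k`), in the binder shapes of `DivisionPointsKernelMembership`; the non-memberships of the `W`/`Z` points now come from
`DeShalitDivisionPointsLatticeVbarCube` (`…_notMem_of_le_span_sq`). [cite: deShalit1987, II §1.5 (15), II §1.10, II §4.4 (iv)] -/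
theorem exists_divisionPt_readings_at_level_of_le_span_sq
    (h6 : ∀ 𝔠 : Ideal (𝓞 K), 𝔠 ≠ ⊥ → ∀ z : ℂ, z ∈ idealInvLattice ι 𝔠 L.lattice → z ∉ L.lattice →
      ∃ x y : rayClassField K (𝔣ψ * 𝔠), algClosureEmb ι x = ℘[L] z ∧ algClosureEmb ι y = ℘'[L] z)
    (hL : ∀ z : ℂ, z ∈ L.lattice ↔ ∃ a ∈ 𝔪, z = Ω * ι (a : K)) (hΩ : Ω ≠ 0)
    (hv0 : v.asIdeal = Ideal.span {π₀}) (htr : π₀ + π₁ = 1) (hβ : β * π₀ - 1 ∈ 𝔪)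
    (h2K : (2 : 𝓞 K) = π₀ * π₁) (hp0 : Prime π₀) (hndvd : ¬ π₀ ∣ π₁) (hprime₁ : Prime π₁) (h𝔪π₁ : 𝔪 ≤ Ideal.span {π₁ ^ 2})
    -- a `𝔭̄`-division point `ub` (`ι(π₁)ub ∈ L`, `ub ∉ L`) and the CM multiplier `αc = ι(π₀)`
    (hub1 : ι (π₁ : K) * ub ∈ L.lattice) (hub0 : ub ∉ L.lattice) {αc : ℂ} (hαc : αc = ι (π₀ : K))
    -- the reading modulus and the local frame
    (h𝔑 : 𝔑 ≠ ⊥) (hv : ¬ 𝔑 ≤ v.asIdeal) (h𝔑ψ : 𝔑 ≤ 𝔣ψ * (𝔪 * Ideal.span {π₁}))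
    {π : 𝒪[v.adicCompletion K]} (hπ : (valuation (v.adicCompletion K)).IsUniformizer (π : v.adicCompletion K))
    {α : 𝓞 K} (hα0 : α ≠ 0) (hα𝔑 : α - 1 ∈ 𝔑) (hαw : ∀ w : HeightOneSpectrum (𝓞 K), w ≠ v → α ∉ w.asIdeal)
    {f : ℕ} (hαπ : ((α : K) : v.adicCompletion K) = (π : v.adicCompletion K) ^ f)
    (E : IntermediateField (v.adicCompletion K) (AlgebraicClosure (v.adicCompletion K)))
    [FiniteDimensional (v.adicCompletion K) E] [Normal (v.adicCompletion K) E]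
    (hdegE : ∀ w : WeilGroup (v.adicCompletion K),
      WeilGroup.toAbsGalois (v.adicCompletion K) w ∈ E.fixingSubgroup → (f : ℤ) ∣ WeilGroup.deg w)
    (m : ℕ) :
    ∃ (xY yY : ℕ → AlgebraicClosure K)
      (XY YY : ℕ → ↥(E ⊔ ltField π m : IntermediateField (v.adicCompletion K) (AlgebraicClosure (v.adicCompletion K))))
      (xS yS : ℕ → ℕ → AlgebraicClosure K)
      (XS YS : ℕ → ℕ → ↥(E ⊔ ltField π m : IntermediateField (v.adicCompletion K) (AlgebraicClosure (v.adicCompletion K))))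
      (xW yW : ℕ → ℕ → AlgebraicClosure K)
      (XW YW : ℕ → ℕ → ↥(E ⊔ ltField π m : IntermediateField (v.adicCompletion K) (AlgebraicClosure (v.adicCompletion K))))
      (xZ yZ : ℕ → ℕ → AlgebraicClosure K)
      (XZ YZ : ℕ → ℕ → ↥(E ⊔ ltField π m : IntermediateField (v.adicCompletion K) (AlgebraicClosure (v.adicCompletion K)))),
      -- `Y`: `ξ(u_{N+1})`
      (∀ N ≤ m, algClosureEmb ι (xY N) =
        ℘[L] ((ι ((β ^ (N + 1) : 𝓞 K) : K) * Ω - Ω / ι ((π₀ ^ (N + 1) : 𝓞 K) : K))) - (W.baseChange ℂ).b₂ / 12) ∧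
      (∀ N ≤ m, algClosureEmb ι (yY N) = (℘'[L] ((ι ((β ^ (N + 1) : 𝓞 K) : K) * Ω - Ω / ι ((π₀ ^ (N + 1) : 𝓞 K) : K))) -
        (W.baseChange ℂ).a₁ * (℘[L] ((ι ((β ^ (N + 1) : 𝓞 K) : K) * Ω - Ω / ι ((π₀ ^ (N + 1) : 𝓞 K) : K))) - (W.baseChange ℂ).b₂ / 12) -
        (W.baseChange ℂ).a₃) / 2) ∧
      (∀ N ≤ m, ((XY N : ↥(E ⊔ ltField π m : IntermediateField (v.adicCompletion K) (AlgebraicClosure (v.adicCompletion K)))) :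
          AlgebraicClosure (v.adicCompletion K)) = (absClosureEmbedding K (v.adicCompletion K)).toRingHom (xY N)) ∧
      (∀ N ≤ m, ((YY N : ↥(E ⊔ ltField π m : IntermediateField (v.adicCompletion K) (AlgebraicClosure (v.adicCompletion K)))) :
          AlgebraicClosure (v.adicCompletion K)) = (absClosureEmbedding K (v.adicCompletion K)).toRingHom (yY N)) ∧
      -- `S`: `ξ(k·u_{N+1} + ub)`
      (∀ N ≤ m, ∀ k : ℕ, algClosureEmb ι (xS N k) = ℘[L] ((k : ℂ) * (ι ((β ^ (N + 1) : 𝓞 K) : K) * Ω - Ω / ι ((π₀ ^ (N + 1) : 𝓞 K) : K)) +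
        ub) - (W.baseChange ℂ).b₂ / 12) ∧
      (∀ N ≤ m, ∀ k : ℕ, algClosureEmb ι (yS N k) = (℘'[L] ((k : ℂ) * (ι ((β ^ (N + 1) : 𝓞 K) : K) * Ω - Ω / ι ((π₀ ^ (N + 1) : 𝓞 K) : K)) +
        ub) - (W.baseChange ℂ).a₁ * (℘[L] ((k : ℂ) * (ι ((β ^ (N + 1) : 𝓞 K) : K) * Ω -
          Ω / ι ((π₀ ^ (N + 1) : 𝓞 K) : K)) + ub) - (W.baseChange ℂ).b₂ / 12) - (W.baseChange ℂ).a₃) / 2) ∧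
      (∀ N ≤ m, ∀ k : ℕ, ((XS N k : ↥(E ⊔ ltField π m : IntermediateField (v.adicCompletion K) (AlgebraicClosure (v.adicCompletion K)))) :
          AlgebraicClosure (v.adicCompletion K)) = (absClosureEmbedding K (v.adicCompletion K)).toRingHom (xS N k)) ∧
      (∀ N ≤ m, ∀ k : ℕ, ((YS N k : ↥(E ⊔ ltField π m : IntermediateField (v.adicCompletion K) (AlgebraicClosure (v.adicCompletion K)))) :
          AlgebraicClosure (v.adicCompletion K)) = (absClosureEmbedding K (v.adicCompletion K)).toRingHom (yS N k)) ∧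
      -- `W`: `ξ(Ω + (k·u_{N+1} + ub))`
      (∀ N ≤ m, ∀ k : ℕ, algClosureEmb ι (xW N k) = ℘[L] (Ω + ((k : ℂ) * (ι ((β ^ (N + 1) : 𝓞 K) : K) * Ω - Ω / ι ((π₀ ^ (N + 1) : 𝓞 K) : K)) +
        ub)) - (W.baseChange ℂ).b₂ / 12) ∧
      (∀ N ≤ m, ∀ k : ℕ, algClosureEmb ι (yW N k) = (℘'[L] (Ω + ((k : ℂ) * (ι ((β ^ (N + 1) : 𝓞 K) : K) * Ω - Ω / ι ((π₀ ^ (N + 1) : 𝓞 K) : K)) +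
        ub)) - (W.baseChange ℂ).a₁ * (℘[L] (Ω + ((k : ℂ) * (ι ((β ^ (N + 1) : 𝓞 K) : K) * Ω -
          Ω / ι ((π₀ ^ (N + 1) : 𝓞 K) : K)) + ub)) - (W.baseChange ℂ).b₂ / 12) - (W.baseChange ℂ).a₃) / 2) ∧
      (∀ N ≤ m, ∀ k : ℕ, ((XW N k : ↥(E ⊔ ltField π m : IntermediateField (v.adicCompletion K) (AlgebraicClosure (v.adicCompletion K)))) :
          AlgebraicClosure (v.adicCompletion K)) = (absClosureEmbedding K (v.adicCompletion K)).toRingHom (xW N k)) ∧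
      (∀ N ≤ m, ∀ k : ℕ, ((YW N k : ↥(E ⊔ ltField π m : IntermediateField (v.adicCompletion K) (AlgebraicClosure (v.adicCompletion K)))) :
          AlgebraicClosure (v.adicCompletion K)) = (absClosureEmbedding K (v.adicCompletion K)).toRingHom (yW N k)) ∧
      -- `Z`: `ξ(αc·(Ω + (k·u_{N+1} + ub)))`
      (∀ N ≤ m, ∀ k : ℕ, algClosureEmb ι (xZ N k) = ℘[L] (αc * (Ω + ((k : ℂ) * (ι ((β ^ (N + 1) : 𝓞 K) : K) * Ω -
        Ω / ι ((π₀ ^ (N + 1) : 𝓞 K) : K)) + ub))) - (W.baseChange ℂ).b₂ / 12) ∧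
      (∀ N ≤ m, ∀ k : ℕ, algClosureEmb ι (yZ N k) = (℘'[L] (αc * (Ω + ((k : ℂ) * (ι ((β ^ (N + 1) : 𝓞 K) : K) * Ω -
        Ω / ι ((π₀ ^ (N + 1) : 𝓞 K) : K)) + ub))) - (W.baseChange ℂ).a₁ * (℘[L] (αc * (Ω + ((k : ℂ) *
          (ι ((β ^ (N + 1) : 𝓞 K) : K) * Ω - Ω / ι ((π₀ ^ (N + 1) : 𝓞 K) : K)) + ub))) -
            (W.baseChange ℂ).b₂ / 12) - (W.baseChange ℂ).a₃) / 2) ∧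
      (∀ N ≤ m, ∀ k : ℕ, ((XZ N k : ↥(E ⊔ ltField π m : IntermediateField (v.adicCompletion K) (AlgebraicClosure (v.adicCompletion K)))) :
          AlgebraicClosure (v.adicCompletion K)) = (absClosureEmbedding K (v.adicCompletion K)).toRingHom (xZ N k)) ∧
      (∀ N ≤ m, ∀ k : ℕ, ((YZ N k : ↥(E ⊔ ltField π m : IntermediateField (v.adicCompletion K) (AlgebraicClosure (v.adicCompletion K)))) :
          AlgebraicClosure (v.adicCompletion K)) = (absClosureEmbedding K (v.adicCompletion K)).toRingHom (yZ N k)) := by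
  subst hαc
  have hπ₀ : π₀ ≠ 0 := hp0.ne_zero
  have hπ₁0 : π₁ ≠ 0 := hprime₁.ne_zero
  have h𝔪0 : 𝔪 ≠ ⊥ := by
    rintro rfl
    obtain ⟨a, ha, h⟩ := (hL _).mp L.ω₁_mem_lattice
    rw [Ideal.mem_bot] at ha
    rw [ha] at h
    simp only [map_zero, mul_zero] at h
    exact L.ω₁_div_two_notMem_lattice (by rw [h, zero_div]; exact L.lattice.zero_mem)
  -- the common division ideal `𝔠_N := 𝔪·(π₀^{N+1}π₁)` and the bound `𝔑·v^{m+1} ≤ 𝔣ψ·𝔠_N` for `N ≤ m`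
  have hne : ∀ N : ℕ, 𝔪 * Ideal.span {π₀ ^ (N + 1) * π₁} ≠ ⊥ := fun N =>
    mul_ne_zero h𝔪0 (show Ideal.span {π₀ ^ (N + 1) * π₁} ≠ ⊥ from
      fun h => mul_ne_zero (pow_ne_zero _ hπ₀) hπ₁0 (Ideal.span_singleton_eq_bot.mp h))
  have hle : ∀ N : ℕ, N ≤ m → 𝔑 * v.asIdeal ^ (m + 1) ≤ 𝔣ψ * (𝔪 * Ideal.span {π₀ ^ (N + 1) * π₁}) := by
    intro N hN
    calc 𝔑 * v.asIdeal ^ (m + 1) ≤ 𝔣ψ * (𝔪 * Ideal.span {π₁}) * v.asIdeal ^ (m + 1) := Ideal.mul_mono_left h𝔑ψ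
      _ = 𝔣ψ * (𝔪 * Ideal.span {π₀ ^ (m + 1) * π₁}) := by
          rw [hv0, Ideal.span_singleton_pow, mul_assoc, mul_assoc, Ideal.span_singleton_mul_span_singleton, mul_comm π₁]
      _ ≤ 𝔣ψ * (𝔪 * Ideal.span {π₀ ^ (N + 1) * π₁}) :=
          Ideal.mul_mono_right (Ideal.mul_mono_right (Ideal.span_singleton_le_span_singleton.mpr
            (mul_dvd_mul_right (pow_dvd_pow π₀ (by omega)) π₁)))
  -- `Y`
  obtain ⟨xY, yY, XY, YY, hxY, hyY, hXY, hYY⟩ := exists_reading_family ι L W h6 (fun N : ℕ => N ≤ m)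
    (fun N => ι ((β ^ (N + 1) : 𝓞 K) : K) * Ω - Ω / ι ((π₀ ^ (N + 1) : 𝓞 K) : K))
    (fun N => 𝔪 * Ideal.span {π₀ ^ (N + 1) * π₁}) (fun N _ => hne N)
    (fun N _ => mem_idealInvLattice_mul_span_of_sub_mem ι L hL
      (c := π₁ * ((β * π₀) ^ (N + 1) - 1)) (by
        rw [show ι ((π₀ ^ (N + 1) * π₁ : 𝓞 K) : K) = ι (π₁ : K) * ι ((π₀ ^ (N + 1) : 𝓞 K) : K) by push_cast; rw [map_mul, mul_comm],
          mul_assoc, pow_mul_divisionPt_eq ι hπ₀ β (N + 1), show ι (π₁ : K) * (Ω * ι ((((β * π₀) ^ (N + 1) - 1 : 𝓞 K)) : K)) -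
            Ω * ι ((π₁ * ((β * π₀) ^ (N + 1) - 1) : 𝓞 K) : K) = 0 by push_cast; rw [map_mul]; ring]
        exact L.lattice.zero_mem))
    (fun N _ => divisionPt_succ_notMem ι hL hΩ h2K hp0 hndvd N)
    h𝔑 hv hπ hα0 hα𝔑 hαw hαπ E hdegE m hle
  -- `S`
  obtain ⟨xS, yS, XS, YS, hxS, hyS, hXS, hYS⟩ := exists_reading_family ι L W h6 (fun i : ℕ × ℕ => i.1 ≤ m)
    (fun i => (i.2 : ℂ) * (ι ((β ^ (i.1 + 1) : 𝓞 K) : K) * Ω - Ω / ι ((π₀ ^ (i.1 + 1) : 𝓞 K) : K)) + ub)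
    (fun i => 𝔪 * Ideal.span {π₀ ^ (i.1 + 1) * π₁}) (fun i _ => hne i.1)
    (fun i _ => translate_mem_idealInvLattice ι L (β := β) hL hπ₀ hub1 i.1 i.2)
    (fun i _ => nsmul_divisionPt_add_notMem ι hL htr hβ hπ₀ hub1 hub0)
    h𝔑 hv hπ hα0 hα𝔑 hαw hαπ E hdegE m (fun i hi => hle i.1 hi)
  -- `W`
  obtain ⟨xW, yW, XW, YW, hxW, hyW, hXW, hYW⟩ := exists_reading_family ι L W h6 (fun i : ℕ × ℕ => i.1 ≤ m)
    (fun i => Ω + ((i.2 : ℂ) * (ι ((β ^ (i.1 + 1) : 𝓞 K) : K) * Ω - Ω / ι ((π₀ ^ (i.1 + 1) : 𝓞 K) : K)) +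
      ub))
    (fun i => 𝔪 * Ideal.span {π₀ ^ (i.1 + 1) * π₁}) (fun i _ => hne i.1)
    (fun i _ => base_add_translate_mem_idealInvLattice ι L (β := β) hL hπ₀ hub1 i.1 i.2)
    (fun i _ => base_add_nsmul_divisionPt_add_notMem_of_le_span_sq ι hL hΩ hprime₁ htr hβ hπ₀ hub1 h𝔪π₁)
    h𝔑 hv hπ hα0 hα𝔑 hαw hαπ E hdegE m (fun i hi => hle i.1 hi)
  -- `Z`
  obtain ⟨xZ, yZ, XZ, YZ, hxZ, hyZ, hXZ, hYZ⟩ := exists_reading_family ι L W h6 (fun i : ℕ × ℕ => i.1 ≤ m)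
    (fun i => ι (π₀ : K) * (Ω + ((i.2 : ℂ) * (ι ((β ^ (i.1 + 1) : 𝓞 K) : K) * Ω - Ω / ι ((π₀ ^ (i.1 + 1) : 𝓞 K) : K)) +
      ub)))
    (fun i => 𝔪 * Ideal.span {π₀ ^ (i.1 + 1) * π₁}) (fun i _ => hne i.1)
    (fun i _ => gen_mul_base_add_translate_mem_idealInvLattice ι L (β := β) hL hπ₀ hub1 i.1 i.2)
    (fun i _ => mul_base_add_nsmul_divisionPt_add_notMem_of_le_span_sq ι hL hΩ hprime₁ htr hβ hπ₀ hub1 h𝔪π₁)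
    h𝔑 hv hπ hα0 hα𝔑 hαw hαπ E hdegE m (fun i hi => hle i.1 hi)
  exact ⟨xY, yY, XY, YY, fun N k => xS (N, k), fun N k => yS (N, k), fun N k => XS (N, k), fun N k => YS (N, k),
    fun N k => xW (N, k), fun N k => yW (N, k), fun N k => XW (N, k), fun N k => YW (N, k),
    fun N k => xZ (N, k), fun N k => yZ (N, k), fun N k => XZ (N, k), fun N k => YZ (N, k),
    hxY, hyY, hXY, hYY,
    fun N hN k => hxS (N, k) hN, fun N hN k => hyS (N, k) hN, fun N hN k => hXS (N, k) hN, fun N hN k => hYS (N, k) hN,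
    fun N hN k => hxW (N, k) hN, fun N hN k => hyW (N, k) hN, fun N hN k => hXW (N, k) hN, fun N hN k => hYW (N, k) hN,
    fun N hN k => hxZ (N, k) hN, fun N hN k => hyZ (N, k) hN, fun N hN k => hXZ (N, k) hN, fun N hN k => hYZ (N, k) hN⟩

end DivisionPointReadings

end Literature.NumberTheory.EllipticCurves

end
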